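import Summits.Ventures.PercRepro2.CaseOnePairPocketConn
import Summits.Ventures.PercRepro2.CaseOnePocketOut
import Summits.Ventures.PercRepro2.CaseOnePocketForms

/-!
# A pocket with two special vertices is a tree gadget: the case-1 forms transfer
(blind cell PercRepro2, p1 g27; the second pocket reduction of the case-1 rung)

The connection events among the preserved vertices — outside `W`, or one of the two designated vertices
`z₁, z₂ ∈ W` — are read through the SAME skeleton set `skelSet ends x z₁ z₂ u v` on both sides
(`connEvent_pair_skel` for `(ends, ω)` through `pairΘ ω = (outOnly P ω, [z₁ ↔ x], [z₂ ↔ x])`,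
`connEvent_pairEnds_skel` for the gadget through `pairΘ' ω = (outOnly P ω, e₁ ∧ e₂, e₁ ∧ e₃)`), so
`expect_pair` transfers every Boolean combination of them (`prob_pair_skel`) and with it every case-1
quantity at `a₃` with the roots outside the pocket and `o, a₃, b` each outside or designated
(`Dpd_pair`, …, `iExprT_pair`): **`fourForms_pair_iff`**, **`closedAt_of_pair`** — for the four case-1
forms a mark-free-otherwise pocket containing two of `o, a₃, b` IS the tree gadget
`x –r– w –s– z₁`, `w –t– z₂`. Own code; standard axioms. -/

namespace Summit.Ventures.PercRepro2

namespace CaseOne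

/-! ## The skeleton -/

section Skel
variable {V : Type*} {E : Type*} [DecidableEq E]

/-- The pocket side read: the outside configuration and the two connections through `P`. -/
noncomputable def pairΘ (ends : E → Sym2 V) (P : Finset E) (x z₁ z₂ : V) (ω : Config E) :
    Config E × Bool × Bool :=
  (outOnly P ω, pkConn ends P z₁ x ω, pkConn ends P z₂ x ω)

/-- The gadget side read: the outside configuration and the two branches. -/
def pairΘ' (P : Finset E) (e₁ e₂ e₃ : E) (ω : Config E) : Config E × Bool × Bool :=
  (outOnly P ω, ω e₁ && ω e₂, ω e₁ && ω e₃)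

open Classical in
/-- A designated vertex projects to the cut vertex, any other vertex to itself. -/
noncomputable def proj (x z₁ z₂ u : V) : V := if u = z₁ ∨ u = z₂ then x else u

/-- A designated vertex is attached when its branch is open. -/
def attached (z₁ z₂ : V) (q : Config E × Bool × Bool) (u : V) : Prop :=
  (u = z₁ → q.2.1 = true) ∧ (u = z₂ → q.2.2 = true)

/-- **The skeleton connection set**: `u ↔ v` in the skeleton — equal, or both attached and their
projections connected in the outside configuration. -/
def skelSet (ends : E → Sym2 V) (x z₁ z₂ u v : V) : Set (Config E × Bool × Bool) :=
  {q | u = v ∨ (attached z₁ z₂ q u ∧ attached z₁ z₂ q v ∧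
    Conn ends q.1 (proj x z₁ z₂ u) (proj x z₁ z₂ v))}

variable {ends : E → Sym2 V} {W : Set V} {x : V} {P : Finset E} {z₁ z₂ : V}

/-- The projection of an outside vertex. -/
lemma proj_of_not_mem (hz₁ : z₁ ∈ W) (hz₂ : z₂ ∈ W) {u : V} (hu : u ∉ W) : proj x z₁ z₂ u = u := by
  have h1 : u ≠ z₁ := fun h => hu (h ▸ hz₁)
  have h2 : u ≠ z₂ := fun h => hu (h ▸ hz₂)
  simp [proj, h1, h2]

/-- The projection of the designated vertices. -/
lemma proj_z₁ : proj x z₁ z₂ z₁ = x := by simp [proj]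

/-- The projection of the designated vertices. -/
lemma proj_z₂ : proj x z₁ z₂ z₂ = x := by simp [proj]

omit [DecidableEq E] in
/-- An outside vertex is attached. -/
lemma attached_of_not_mem (hz₁ : z₁ ∈ W) (hz₂ : z₂ ∈ W) {u : V} (hu : u ∉ W)
    (q : Config E × Bool × Bool) : attached z₁ z₂ q u :=
  ⟨fun h => absurd (h ▸ hz₁) hu, fun h => absurd (h ▸ hz₂) hu⟩

omit [DecidableEq E] in
/-- `z₁` is attached iff its branch is open. -/
lemma attached_z₁ (hz : z₁ ≠ z₂) (q : Config E × Bool × Bool) :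
    attached z₁ z₂ q z₁ ↔ q.2.1 = true := by
  simp [attached, hz]

omit [DecidableEq E] in
/-- `z₂` is attached iff its branch is open. -/
lemma attached_z₂ (hz : z₁ ≠ z₂) (q : Config E × Bool × Bool) :
    attached z₁ z₂ q z₂ ↔ q.2.2 = true := by
  simp [attached, hz.symm]

/-- **The connection events of `G` among the preserved vertices, through the skeleton.** -/
theorem connEvent_pair_skel (h : IsPocket ends W x P) (hz₁ : z₁ ∈ W) (hz₂ : z₂ ∈ W) (hz : z₁ ≠ z₂)
    {u v : V} (hu : u ∉ W ∨ u = z₁ ∨ u = z₂) (hv : v ∉ W ∨ v = z₁ ∨ v = z₂)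
    (hsep : u = v ∨ u ∉ W ∨ v ∉ W) :
    connEvent ends u v = pairΘ ends P x z₁ z₂ ⁻¹' skelSet ends x z₁ z₂ u v := by
  ext ω
  simp only [mem_connEvent, Set.mem_preimage, skelSet, Set.mem_setOf_eq, pairΘ]
  rcases eq_or_ne u v with rfl | huv
  · exact ⟨fun _ => Or.inl rfl, fun _ => conn_refl _ _ _⟩
  simp only [huv, false_or]
  rcases hu with hu | rfl | rfl
  · rcases hv with hv | rfl | rfl
    · -- both outside
      rw [proj_of_not_mem hz₁ hz₂ hu, proj_of_not_mem hz₁ hz₂ hv, conn_outOnly_iff ω h hu hv]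
      exact ⟨fun hc => ⟨attached_of_not_mem hz₁ hz₂ hu _, attached_of_not_mem hz₁ hz₂ hv _, hc⟩,
        fun hc => hc.2.2⟩
    · -- `u` outside, `v = z₁`
      rw [proj_of_not_mem hz₁ hz₂ hu, proj_z₁, attached_z₁ hz]
      simp only [pkConn_eq_true_iff]
      constructor
      · intro hc
        have := (conn_of_mem_iff ω h hz₁ hu).1 (conn_symm hc)
        exact ⟨attached_of_not_mem hz₁ hz₂ hu _, this.1, conn_symm this.2⟩
      · rintro ⟨-, hin, hout⟩
        exact conn_symm ((conn_of_mem_iff ω h hz₁ hu).2 ⟨hin, conn_symm hout⟩)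
    · -- `u` outside, `v = z₂`
      rw [proj_of_not_mem hz₁ hz₂ hu, proj_z₂, attached_z₂ hz]
      simp only [pkConn_eq_true_iff]
      constructor
      · intro hc
        have := (conn_of_mem_iff ω h hz₂ hu).1 (conn_symm hc)
        exact ⟨attached_of_not_mem hz₁ hz₂ hu _, this.1, conn_symm this.2⟩
      · rintro ⟨-, hin, hout⟩
        exact conn_symm ((conn_of_mem_iff ω h hz₂ hu).2 ⟨hin, conn_symm hout⟩)
  · rcases hv with hv | rfl | rfl
    · -- `u = z₁`, `v` outside
      rw [proj_of_not_mem hz₁ hz₂ hv, proj_z₁, attached_z₁ hz]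
      simp only [pkConn_eq_true_iff]
      constructor
      · intro hc
        have := (conn_of_mem_iff ω h hz₁ hv).1 hc
        exact ⟨this.1, attached_of_not_mem hz₁ hz₂ hv _, this.2⟩
      · rintro ⟨hin, -, hout⟩
        exact (conn_of_mem_iff ω h hz₁ hv).2 ⟨hin, hout⟩
    · exact absurd rfl huv
    · rcases hsep with h' | h' | h'
      · exact absurd h' huv
      · exact absurd hz₁ h'
      · exact absurd hz₂ h'
  · rcases hv with hv | rfl | rfl
    · -- `u = z₂`, `v` outside
      rw [proj_of_not_mem hz₁ hz₂ hv, proj_z₂, attached_z₂ hz]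
      simp only [pkConn_eq_true_iff]
      constructor
      · intro hc
        have := (conn_of_mem_iff ω h hz₂ hv).1 hc
        exact ⟨this.1, attached_of_not_mem hz₁ hz₂ hv _, this.2⟩
      · rintro ⟨hin, -, hout⟩
        exact (conn_of_mem_iff ω h hz₂ hv).2 ⟨hin, hout⟩
    · rcases hsep with h' | h' | h'
      · exact absurd h' huv
      · exact absurd hz₂ h'
      · exact absurd hz₁ h'
    · exact absurd rfl huv

variable {e₁ e₂ e₃ : E} {w : V}

/-- **The connection events of the gadget among the preserved vertices, through the skeleton.** -/
theorem connEvent_pairEnds_skel (hh : IsPairPocket ends W x P e₁ e₂ e₃ w z₁ z₂) {u v : V}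
    (hu : u ∉ W ∨ u = z₁ ∨ u = z₂) (hv : v ∉ W ∨ v = z₁ ∨ v = z₂) (hsep : u = v ∨ u ∉ W ∨ v ∉ W) :
    connEvent (pairEnds ends P e₁ e₂ e₃ x w z₁ z₂) u v =
      pairΘ' P e₁ e₂ e₃ ⁻¹' skelSet ends x z₁ z₂ u v := by
  have hz₁ := hh.mem_z₁
  have hz₂ := hh.mem_z₂
  have hz := hh.ne_z
  ext ω
  simp only [mem_connEvent, Set.mem_preimage, skelSet, Set.mem_setOf_eq, pairΘ']
  rcases eq_or_ne u v with rfl | huv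
  · exact ⟨fun _ => Or.inl rfl, fun _ => conn_refl _ _ _⟩
  simp only [huv, false_or]
  rcases hu with hu | rfl | rfl
  · rcases hv with hv | rfl | rfl
    · rw [proj_of_not_mem hz₁ hz₂ hu, proj_of_not_mem hz₁ hz₂ hv, conn_pairEnds_out_iff ω hh hu hv]
      exact ⟨fun hc => ⟨attached_of_not_mem hz₁ hz₂ hu _, attached_of_not_mem hz₁ hz₂ hv _, hc⟩,
        fun hc => hc.2.2⟩
    · rw [proj_of_not_mem hz₁ hz₂ hu, proj_z₁, attached_z₁ hz]
      simp only [Bool.and_eq_true]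
      constructor
      · intro hc
        have := (conn_pairEnds_z₁_iff ω hh hu).1 (conn_symm hc)
        exact ⟨attached_of_not_mem hz₁ hz₂ hu _, ⟨this.1, this.2.1⟩, conn_symm this.2.2⟩
      · rintro ⟨-, ⟨h1, h2⟩, hout⟩
        exact conn_symm ((conn_pairEnds_z₁_iff ω hh hu).2 ⟨h1, h2, conn_symm hout⟩)
    · rw [proj_of_not_mem hz₁ hz₂ hu, proj_z₂, attached_z₂ hz]
      simp only [Bool.and_eq_true]
      constructor
      · intro hc
        have := (conn_pairEnds_z₂_iff ω hh hu).1 (conn_symm hc)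
        exact ⟨attached_of_not_mem hz₁ hz₂ hu _, ⟨this.1, this.2.1⟩, conn_symm this.2.2⟩
      · rintro ⟨-, ⟨h1, h3⟩, hout⟩
        exact conn_symm ((conn_pairEnds_z₂_iff ω hh hu).2 ⟨h1, h3, conn_symm hout⟩)
  · rcases hv with hv | rfl | rfl
    · rw [proj_of_not_mem hz₁ hz₂ hv, proj_z₁, attached_z₁ hz]
      simp only [Bool.and_eq_true]
      constructor
      · intro hc
        have := (conn_pairEnds_z₁_iff ω hh hv).1 hc
        exact ⟨⟨this.1, this.2.1⟩, attached_of_not_mem hz₁ hz₂ hv _, this.2.2⟩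
      · rintro ⟨⟨h1, h2⟩, -, hout⟩
        exact (conn_pairEnds_z₁_iff ω hh hv).2 ⟨h1, h2, hout⟩
    · exact absurd rfl huv
    · rcases hsep with h' | h' | h'
      · exact absurd h' huv
      · exact absurd hz₁ h'
      · exact absurd hz₂ h'
  · rcases hv with hv | rfl | rfl
    · rw [proj_of_not_mem hz₁ hz₂ hv, proj_z₂, attached_z₂ hz]
      simp only [Bool.and_eq_true]
      constructor
      · intro hc
        have := (conn_pairEnds_z₂_iff ω hh hv).1 hc
        exact ⟨⟨this.1, this.2.1⟩, attached_of_not_mem hz₁ hz₂ hv _, this.2.2⟩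
      · rintro ⟨⟨h1, h3⟩, -, hout⟩
        exact (conn_pairEnds_z₂_iff ω hh hv).2 ⟨h1, h3, hout⟩
    · rcases hsep with h' | h' | h'
      · exact absurd h' huv
      · exact absurd hz₂ h'
      · exact absurd hz₁ h'
    · exact absurd rfl huv

end Skel

/-! ## The transfer of probabilities -/

section PairProb
variable {V : Type*} {E : Type*} [Fintype E] [DecidableEq E] {R : Type*} [Field R] [LinearOrder R]
  [IsStrictOrderedRing R]
variable {p : E → R} (ends : E → Sym2 V) (P : Finset E) {e₁ e₂ e₃ : E} (x z₁ z₂ : V)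

/-- **Every event read through the skeleton has the same probability under the gadget.** -/
theorem prob_pair_skel (hp : IsProbVec p) (he₁ : e₁ ∈ P) (he₂ : e₂ ∈ P) (he₃ : e₃ ∈ P) (h12 : e₁ ≠ e₂) (h13 : e₁ ≠ e₃)
    (h23 : e₂ ≠ e₃) (S : Set (Config E × Bool × Bool)) :
    prob p (pairΘ ends P x z₁ z₂ ⁻¹' S) =
      prob (pairW p ends P e₁ e₂ e₃ x z₁ z₂) (pairΘ' P e₁ e₂ e₃ ⁻¹' S) := by
  rw [prob_eq_expect_indicator, prob_eq_expect_indicator]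
  have h := expect_pair hp ends P x z₁ z₂ he₁ he₂ he₃ h12 h13 h23
    (fun ω₁ a b => S.indicator 1 (ω₁, a, b))
  exact h

end PairProb

end CaseOne

end Summit.Ventures.PercRepro2
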